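import Literature.NumberTheory.EllipticCurves.Kato2004.MemberHullValueInputs
import Literature.NumberTheory.EllipticCurves.Kato2004.MemberHullCountInputs
import Literature.NumberTheory.EllipticCurves.Kato2004.IntegralH1FiniteProofs
import Literature.NumberTheory.EllipticCurves.KatoRankBoundSelmerProofs
import HarnessLib

/-!
# Kato 2004 (Astérisque 295) at Kato's member — the VALUE-GUARDED package WITH THE TWO PRINTED COUNTS:
# structure `MemberHullCountValueInputs` (= `MemberHullValueInputs` with the composite clause `count`
# REPLACED by the two printed counts (C1), (C2) of `MemberCountInputs`), its exact count, and the
# conversions to `MemberHullValueInputs` and from a pair `(MemberHullInputs, MemberCountInputs)`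
# — STRUCTURE AND CONVERSIONS ONLY (no named fact; zero debt)

Topic `NumberTheory/EllipticCurves`, sub-directory `Kato2004` (namespace = path).  Seat `bsd-potss-rkm`
(generation 11, cell `bsd-potss`; crux M = item stmt-BirchSwinnertonDyer-19196 `ReducibleKatoMember` of
the routes K9 / K8-t′, and the held count input stmt-BirchSwinnertonDyer-19707
`PublishedInputMemberHullCountInputs` of the U₀-red items 19190 / 19203).

WHY.  The cell holds TWO cite-level transcriptions of Kato's rank-`0` descent at his member
`T = T_pW_K ≅ V_{ℤ_p}(f)(1)`:
* `Kato2004.exists_memberHullZetaInputs` (file `MemberHullZetaInputs.lean`, held child of crux M) — and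
  its value-guarded sibling `Kato2004.exists_memberHullValueInputs` (file `MemberHullValueInputs.lean`,
  seat rkm g10), whose structure `MemberHullValueInputs` is the zeta package MINUS the four clauses
  `z_ne_zero`, `isTorsion_quotient`, `lam_constantCoeff_ne_zero`, `index_ne_zero` (theorems of the tree on
  the lift of a guarded `ZetaBody` witness), but which still carries the COMPOSITE clause `count`
  (Prop. 14.16 (2) + §14.8 / Greenberg + Kim §3.2.3 + Thm. 12.5 (1) summed into ONE inequality with the
  torsion slack `3·ord_p #W(ℚ)_tors`);
* `Kato2004.exists_memberHullCountInputs` (file `MemberHullCountInputs.lean`, seat kmc part 16, held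
  input of U₀-red) — the pair `(P : MemberHullInputs, MemberCountInputs … P)`: the ORIGINAL package
  `MemberHullInputs` (all eight algebraic/value clauses that are now theorems — `finite_H`,
  `torsionFree_H`, `ι_injective`, `finite_coinvariants_H2` (rkm g8/g9, cn100) and the four above (rkm
  g10) — still in hypothesis position) PLUS the two PRINTED counts (C1) Kato's count of (14.9.3) and (C2)
  the Poitou–Tate count of `Sel(T) ⊂ S(T)` (module docstring of `MemberHullCountInputs.lean`, verbatim
  quotations there), whose sum is the EXACT count with `2·ord_p #tors`, plus `finite_torsion_A`
  (Thm. 14.5 (1), a theorem: `A ≅ H¹(ℤ[1/p],T)` is finitely generated over `ℤ_p`).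
The structure of THIS file is the common refinement: `MemberHullCountValueInputs W p κ γ I 𝐲` := the field
list of `MemberHullValueInputs` with `count` REMOVED and the fields `S`, `finite_S`, `Sel`, `card_Sel`,
`index_Sel` (C2), `count_S` (C1) of `MemberCountInputs` ADDED (written over this package's own pinned
`A`, `ι`, `lam`, `H2`; same names, types and pins as in the two source files; `finite_torsion_A` omitted,
proved below).  So every clause of the package is ONE printed statement of the two module docstrings
(`MemberHullValueInputs.lean`, `MemberHullCountInputs.lean`), and no clause is a tree theorem.

WHAT IS PROVED HERE (kernel, no arithmetic input):
* `MemberHullCountValueInputs.exactCount` — (C1) + (C2) + `#Sel = #Ш[p^∞]`: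
  `ord_p #Ш(W)[p^∞] + v_p Tam(W) + ord_p [A : Λ·ι(𝐲̄)] = ord_p(L(W,1)/Ω(W)) + v_p λ(0) + ord_p #(𝐇²/X𝐇²)
  + 2·ord_p #W(ℚ)_tors` (the intermediate orders `#S(T)`, `#A_tors`, `v_p(c_p)` cancel; = seat kmc's
  `MemberCountInputs.exactCount` over this package);
* `MemberHullCountValueInputs.toMemberHullValueInputs` — the value package, its `count` (`≤ … + 3t`)
  supplied by `exactCount` (`2t ≤ 3t`);
* `MemberHullCountValueInputs.ofCount` — a pair `(P, C : MemberCountInputs … P)` forgets to this package;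
* `MemberHullValueInputs.finite_torsion_A'` / `MemberHullCountValueInputs.finite_torsion_A` — Thm. 14.5 (1)
  on every package: the torsion of the pinned `A` is finite (`module_finite_integralH1_layerZero`,
  `ZpCorank.finite_torsion`; the Summits twin for `MemberHullInputs` is
  `IntegralH1RankZero.MemberHullInputs.finite_torsion_A`);
* `MemberHullCountValueInputs.toMemberCountInputs` — back to kmc's pair over the `MemberHullInputs`
  package obtained from `toMemberHullValueInputs` by the sibling conversions, the eight dropped clauses
  SUPPLIED as hypotheses (they are discharged Summits-side on every pin of the member:
  `Theorems/KatoDescentPotSupersingularReducibleKatoMemberOfCountValueInputsNodes.lean`, seat rkm g11);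
* `exists_memberHullValueInputs_of_countValue` — the FACT-LEVEL forgetful theorem: the `∀∃` shell of
  `exists_memberHullValueInputs` with `MemberHullCountValueInputs` for `MemberHullValueInputs` (displayed
  as the hypothesis, NOT named — see below) implies `exists_memberHullValueInputs` (hence, Summits-side,
  `exists_memberHullZetaInputs` and crux M given GZK, rkm g10 p528760).

NO NAMED FACT IS FILED HERE (review ruling on `MemberHullIdealInputs.lean`, p531968 → p534310, and ARM P
(482)(g)/(484)(d): a further `def … : Prop` sibling of the held facts is debt unless it RETIRES facts).
TURNKEY FOR THE PLANNER (optional consolidation, net debt −1): ONE held child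
`PublishedInputMemberHullCountValueInputs(T) := <the hypothesis of exists_memberHullValueInputs_of_countValue>`
can replace BOTH `PublishedInputMemberHullZetaInputs` (crux M 19196's Z-child, K9 20278 / KT twin) and
`PublishedInputMemberHullCountInputs` (U₀-red 19190 / 19203's child 19707), with the glue closed by the
Summits-side theorems `ReducibleOfCountValueInputs.katoMemberShaBoundOfReducible_of_countValue` (M, with
modularity + GZK) and `ReducibleOfCountValueInputs.exists_memberHullCountInputs_of_countValue` (→ every
existing consumer of `exists_memberHullCountInputs`, with GZK); the `def` is filed at resplit time with
the shell below verbatim.  Until then this file changes no item and no trust base.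

HONEST SCOPE.  Nothing is booked; BSD is not advanced; the package is weaker than print exactly as its two
sources are (abstract `F`, `𝐇²`, `S`, `Sel`; "WHAT THE FIELDS DO AND DO NOT PIN" in both source files
applies verbatim); no `_holds` is expected for the shell (size XL: Kato's Euler system, explicit
reciprocity, Poitou–Tate).  Referee flags as for the sources
(`Kato-12.6-13.10-14.16(2)-member-reading-reducible`, `Kato-14.9.3-count-Af-symbolic-member-reducible`).

## References

* K. Kato, *p-adic Hodge theory and values of zeta functions of modular forms*, Astérisque 295 (2004):
  (12.2.1) (p. 220), Thm. 12.4 (1) (p. 221), Thm. 12.5 (3) (p. 222), Thm. 12.6, Rem. 12.7 (p. 222),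
  Lemma 13.10 (1) (p. 230), 13.14 (p. 234), §14.1 and Cor. 14.3 (pp. 234–235), Thm. 14.5 (pp. 236–237),
  §14.8 (p. 238), (14.9.3)–(14.10.1) (pp. 239–240), §14.14 (14.14.1)–(14.14.2) (p. 243), Prop. 14.16 and
  its proof (14.16.1)–(14.16.3) (pp. 244–245) — store key `paper:doi-10-24033-ast-639`, read through
  `MemberHullInputs.lean` / `MemberHullCountInputs.lean` (verbatim quotations there). [Kato2004Asterisque]
* C. Wuthrich, Doc. Math. 19 (2014), Lemma 12 (p. 395), Lemma 14 (p. 396). [Wuthrich2014]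
* R. Greenberg, LNM 1716 (1999), §3 after Lemma 3.3; appendix to §4; Prop. 4.13. [GreenbergLNM1716]
* J. Coates, LNM 1716 (1999), Lemma 3.8 with proof (p. 34). [CoatesLNM1716]
* C.-H. Kim, Amer. J. Math. 148 (2026), §3.2.3. [Kim2022StructureSelmer]
* Tree: `MemberHullValueInputs.lean`, `MemberHullCountInputs.lean`, `MemberHullZetaInputs.lean`,
  `MemberHullInputs.lean` (the sources); `IntegralH1FiniteProofs.lean`, `KatoRankBoundSelmerProofs.lean`
  (`finite_torsion_A`); Summits side (not imported):
  `Theorems/KatoDescentPotSupersingularReducibleKatoMemberOfCountValueInputsNodes.lean`.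
-/

noncomputable section

open scoped NumberField TensorProduct
open Field IsDedekindDomain CongruenceSubgroup
open Literature.NumberTheory.GaloisRepresentations
open Literature.NumberTheory.EllipticCurves Literature.NumberTheory.EllipticCurves.ModularForms
open Literature.NumberTheory.EllipticCurves.Kato2004
open Literature.NumberTheory.EllipticCurves.Kato2004.EulerSystemValues Rat.HeightOneSpectrum
open Literature.NumberTheory.EllipticCurves.IwasawaAlgebra

namespace Literature.NumberTheory.EllipticCurves.Kato2004

section Package

variable (W : WeierstrassCurve ℚ) [W.IsElliptic] (p : ℕ) [Fact p.Prime]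
  [ContinuousSMul ℤ_[p] (W.tateModule p)] (κ : ZpExtension ℚ p) (γ : absoluteGaloisGroup ℚ)
  (I : IwasawaH1Data W p κ γ) (y : I.H)

/-- **Kato's rank-`0` descent inputs at his own lattice, VALUE-GUARDED, WITH THE TWO PRINTED COUNTS —
hypothesis structure (a package of the printed statements; nothing asserted).**  For an elliptic curve
`W/ℚ` (intended: Kato's member `W_K`, `T_pW ≅ V_{ℤ_p}(f)(1)`), a pinned Iwasawa cohomology
`I : IwasawaH1Data W p κ γ` and an element `y : I.H` (the `Λ`-adic class of a `ZetaBody` family): EXACTLY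
the fields of `MemberHullValueInputs` — the reflexive hull `j : I.H ↪ F` (13.14 / Wuthrich L.12) with
Kato's `z = z_γ⁰` and the multiplier `lam` of Lemma 13.10 (1), `j y = lam • z`; the abstract
`H2 = 𝐇²(T)⁰`, finitely generated torsion ((12.2.1), Thm. 12.4 (1)); `A = H¹(ℤ[1/p],T)` PINNED by `toH1`;
the maps `ι`, `π` of (14.14.1) with the pin of `ι`; Thm. 12.5 (3) + Rem. 12.7 off `(p)`; `μ(𝐇²(T)⁰) = 0`
(Wuthrich L.14) — EXCEPT the composite clause `count`, which is REPLACED by the fields of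
`MemberCountInputs` (module docstring of `MemberHullCountInputs.lean`, (C1)/(C2)): Kato's `S(T)` (§14.8)
with `Sel(T) ⊂ S(T)` (§14.1), abstract finite groups, `#Sel(T) = #Ш(W)[p^∞]` (Cor. 14.3); (C2) the
Poitou–Tate count of `S/Sel` (Greenberg §3 `|ker r_v| = c_v^{(p)}`, appendix to §4 + Cassels' theorem,
Coates Lemma 3.8, `S_{T*}(ℚ) = H¹_f(ℤ[1/p],T) = A_tors`, Kato p. 244); (C1) Kato's count of (14.9.3) in the
proof of Prop. 14.16 for `𝐲₀ = ι(𝐲̄) = λ(0)·z_γ` with `#H¹_f(ℤ[1/p],T) = #A_tors` kept symbolic, the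
local index by Kim §3.2.3 + Thm. 12.5 (1), `#H²(ℤ[1/p],T) = #(𝐇²/X𝐇²)` ((14.14.2)).  Same names, types,
pins as the two source structures; `finite_torsion_A` is omitted (a theorem, `finite_torsion_A` below).
[cite: Kato2004Asterisque, Thm. 12.4 (1) (p. 221), Thm. 12.5 (3) (p. 222), Thm. 12.6 and Rem. 12.7 (p. 222), Lemma 13.10 (1) (p. 230), 13.14 (p. 234), §14.1 and Cor. 14.3 (pp. 234–235), §14.8 (p. 238), (14.9.3) and (14.10.1) (pp. 239–240), §14.14 (14.14.1)–(14.14.2) (p. 243), proof of Prop. 14.16 (14.16.1)–(14.16.3) (pp. 244–245), Thm. 12.5 (1) (p. 221)]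
[cite: Wuthrich2014, Lemma 12 (p. 395), Lemma 14 (p. 396)]
[cite: GreenbergLNM1716, §3 paragraph after Lemma 3.3; appendix to §4; Prop. 4.13 and Cassels' theorem]
[cite: CoatesLNM1716, Lemma 3.8 with proof (p. 34)] [cite: Kim2022StructureSelmer, §3.2.3 display before Thm. 3.7 (PDF p. 16)] -/
structure MemberHullCountValueInputs : Type 1 where
  /-- The reflexive hull `F = (𝐇¹_Γ)^{**}` (13.14 / Wuthrich L.12), abstract. -/
  F : Type
  [addCommGroupF : AddCommGroup F]
  [moduleF : _root_.Module (IwasawaAlgebra p) F]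
  /-- `F` is finitely generated. -/
  finite_F : Module.Finite (IwasawaAlgebra p) F
  /-- `F` is torsion free. -/
  torsionFree_F : NoZeroSMulDivisors (IwasawaAlgebra p) F
  /-- The inclusion `𝐇¹_Γ ↪ (𝐇¹_Γ)^{**}`. -/
  j : I.H →ₗ[IwasawaAlgebra p] F
  /-- `j` is injective. -/
  j_injective : Function.Injective j
  /-- The hull has finite (pseudo-null) cokernel. -/
  finite_coker : Finite (F ⧸ LinearMap.range j)
  /-- Kato's normalised zeta element `z_γ⁰` (`γ^+` a `ℤ_p`-basis of `T(−1)^+`), in the hull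
  (Thm. 12.6 + 13.14). -/
  z : F
  /-- Lemma 13.10 (1): the multiplier `λ ∈ Λ` of the `(c,d,a(A))`-class. -/
  lam : IwasawaAlgebra p
  /-- Lemma 13.10 (1): `j y = λ • z_γ⁰`. -/
  j_y : j y = lam • z
  /-- `H2 = 𝐇²(T)⁰`, abstract. -/
  H2 : Type
  [addCommGroupH2 : AddCommGroup H2]
  [moduleH2 : _root_.Module (IwasawaAlgebra p) H2]
  /-- (12.2.1): `𝐇²` is finitely generated. -/
  finite_H2 : Module.Finite (IwasawaAlgebra p) H2
  /-- Thm. 12.4 (1): `𝐇²` is torsion. -/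
  isTorsion_H2 : Module.IsTorsion (IwasawaAlgebra p) H2
  /-- `A = H¹(ℤ[1/p], T)` as a `Λ`-module (through the augmentation), pinned by `toH1`. -/
  A : Type
  [addCommGroupA : AddCommGroup A]
  [moduleA : _root_.Module (IwasawaAlgebra p) A]
  /-- The PIN of `A`: an additive map to `H¹(ℚ, T_pW)` at the bottom layer `κ.layerSubgroup 0 = Γ_ℚ` … -/
  toH1 : A →+ H1 (tateRep W p) (κ.layerSubgroup 0)
  /-- … injective … -/
  toH1_injective : Function.Injective toH1
  /-- … with image exactly the integral classes `H¹(ℤ[1/p], T_pW)` (§8.2, Lemma 8.5) … -/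
  mem_range_toH1_iff : ∀ x : H1 (tateRep W p) (κ.layerSubgroup 0),
    x ∈ Set.range toH1 ↔ x ∈ integralH1 (tateRep W p) p (κ.layerSubgroup 0)
  /-- … and `Λ` acting on `A` through the augmentation `g ↦ g(0)` (so `X` acts as `0`). -/
  toH1_smul : ∀ (g : IwasawaAlgebra p) (a : A), toH1 (g • a) = PowerSeries.constantCoeff g • toH1 a
  /-- (14.14.1), first map `𝐇¹_Γ/X𝐇¹_Γ → H¹(ℤ[1/p],T)`. -/
  ι : coinvariants p I.H →ₗ[IwasawaAlgebra p] A
  /-- (14.14.1), second map `H¹(ℤ[1/p],T) → 𝐇²[X]`. -/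
  π : A →ₗ[IwasawaAlgebra p] invariants p H2
  /-- (14.14.1): `π` surjective. -/
  π_surjective : Function.Surjective π
  /-- (14.14.1): exact in the middle. -/
  exact_ι_π : Function.Exact ι π
  /-- The PIN of `ι`: `ι(x mod X) = proj₀ x` in `H¹(ℚ, T_pW)` (§13.8 / (14.14.1); `IwasawaH1Data.projZero`). -/
  toH1_ι : ∀ x : I.H, toH1 (ι (Submodule.Quotient.mk x)) = I.proj 0 x
  /-- Thm. 12.5 (3) with Rem. 12.7 (potentially good `p`: `𝐇²_loc = 0`), on the `Δ`-trivial component: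
  `ℓ_𝔮(𝐇²) ≤ ℓ_𝔮(F/Λz_γ)` at every height-one `𝔮 ≠ (p)`. -/
  divisibility_offP : ∀ 𝔮 : PrimeSpectrum (IwasawaAlgebra p), 𝔮.asIdeal.height = 1 →
    𝔮.asIdeal ≠ augIdealP p →
      Module.lengthAt (IwasawaAlgebra p) H2 𝔮 ≤
        Module.lengthAt (IwasawaAlgebra p) (F ⧸ (IwasawaAlgebra p) ∙ z) 𝔮
  /-- Wuthrich 2014 Lemma 14 + global duality (reducible `W[p]`, `p` odd): `μ(𝐇²(T)⁰) = 0`. -/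
  mu_H2 : muInvariant p H2 = 0
  /-- Kato's `S(T)` (§14.8), abstract. -/
  S : Type
  [addCommGroupS : AddCommGroup S]
  /-- Thm. 14.2 / 14.5: `S(T)` is finite (`L(f,1) ≠ 0`). -/
  finite_S : Finite S
  /-- `Sel(T) = Sel_{p^∞}(E/ℚ) ⊂ S(T)` (§14.1, §14.8). -/
  Sel : AddSubgroup S
  /-- §14.1 + Cor. 14.3 (`E(ℚ)` finite, so `E(ℚ) ⊗ ℚ_p/ℤ_p = 0`): `#Sel(T) = #Ш(W)[p^∞]`. -/
  card_Sel : Nat.card Sel = Nat.card (AddCommGroup.primaryComponent W.sha p)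
  /-- (C2) `ord_p #S(T) + t = ord_p #Sel(T) + Σ_{ℓ≠p} v_p(c_ℓ) + ord_p #H¹_f(ℤ[1/p],T)` — the exact sequence
  `0 → S/Sel → ⊕_{ℓ≠p} H¹_ur(ℚ_ℓ,E[p^∞]) → coker γ_{L⁰} → coker γ_L → 0` with `#H¹_ur(ℚ_ℓ,E[p^∞]) = c_ℓ^{(p)}`
  (Greenberg §3), `#coker γ_{L⁰} = #E(ℚ)[p^∞]` (Cassels' theorem), `coker γ_L ≅ S_{T*}(ℚ)^∨`,
  `S_{T*}(ℚ) = H¹_f(ℤ[1/p],T) = H¹(ℤ[1/p],T)_tors` (Greenberg app. §4, Coates L.3.8, Kato p. 244);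
  `Σ_{ℓ≠p} v_p(c_ℓ)` is written `v_p(Tam W) − v_p(c_p(W))`. -/
  index_Sel : (padicValNat p (Nat.card S) : ℤ) + padicValNat p W.torsionOrder =
    (padicValNat p (Nat.card Sel) : ℤ) + padicValNat p W.tamagawaProduct -
      padicValNat p ((W.baseChange ℚ_[p]).localTamagawaNumber ℤ_[p]) +
      padicValNat p (Nat.card (AddCommGroup.torsion A))
  /-- (C1) Kato's count of (14.9.3) for `𝐲₀ = ι(𝐲̄)` (proof of Prop. 14.16 with `#H¹_f(ℤ[1/p],T) =
  #H¹(ℤ[1/p],T)_tors` kept, (14.10.1), local duality, Kim §3.2.3, Thm. 12.5 (1), Lemma 13.10 (1), (14.14.2)):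
  `ord_p #S(T) + ord_p [A : Λ·ι(𝐲̄)] = ord_p(L(W,1)/Ω(W)) + v_p λ(0) − v_p(c_p) + ord_p #A_tors +
  ord_p #(𝐇²/X𝐇²) + t`. -/
  count_S : ∃ q : ℚ, W.entireLFunction 1 / (W.realPeriodRat : ℂ) = (q : ℂ) ∧
    (padicValNat p (Nat.card S) : ℤ) +
        padicValNat p (Nat.card (A ⧸ (IwasawaAlgebra p) ∙ ι (Submodule.Quotient.mk y))) =
      padicValRat p q + ((PowerSeries.constantCoeff lam).valuation : ℤ) -
        padicValNat p ((W.baseChange ℚ_[p]).localTamagawaNumber ℤ_[p]) +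
        padicValNat p (Nat.card (AddCommGroup.torsion A)) +
        padicValNat p (Nat.card (coinvariants p H2)) + padicValNat p W.torsionOrder

attribute [instance] MemberHullCountValueInputs.addCommGroupF MemberHullCountValueInputs.moduleF
  MemberHullCountValueInputs.addCommGroupH2 MemberHullCountValueInputs.moduleH2
  MemberHullCountValueInputs.addCommGroupA MemberHullCountValueInputs.moduleA
  MemberHullCountValueInputs.addCommGroupS

end Package

/-! ## Kernel: the exact count, `finite_torsion_A`, and the conversions (no arithmetic input) -/

section Conversions

variable {W : WeierstrassCurve ℚ} [W.IsElliptic] {p : ℕ} [Fact p.Prime]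
  [ContinuousSMul ℤ_[p] (W.tateModule p)] {κ : ZpExtension ℚ p} {γ : absoluteGaloisGroup ℚ}
  {I : IwasawaH1Data W p κ γ} {y : I.H}

/-- **Thm. 14.5 (1) on every VALUE package: the torsion of the pinned `A ≅ H¹(ℤ[1/p], T_pW)` is
finite** — `H¹(ℤ[1/p], T_pW)` at the bottom layer is a finitely generated `ℤ_p`-module
(`module_finite_integralH1_layerZero`) whose torsion is finite (`ZpCorank.finite_torsion`), transported
along the injective pin `toH1`; no hypothesis on `W` or `p`.  (Literature twin of the Summits theorem
`IntegralH1RankZero.MemberHullInputs.finite_torsion_A`, same proof.)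
[cite: Kato2004Asterisque, Thm. 14.5 (1) (p. 236) and §8.2 / Lemma 8.5 (pp. 180–184)] -/
theorem MemberHullValueInputs.finite_torsion_A' (V : MemberHullValueInputs W p κ γ I y) :
    Finite (AddCommGroup.torsion V.A) := by
  haveI := module_finite_integralH1_layerZero W p κ
  haveI := ZpCorank.finite_torsion p (integralH1 (tateRep W p) p (κ.layerSubgroup 0))
  have hmem : ∀ a : V.A, V.toH1 a ∈ integralH1 (tateRep W p) p (κ.layerSubgroup 0) := fun a =>
    (V.mem_range_toH1_iff _).mp ⟨a, rfl⟩
  refine Finite.of_injective (fun a : AddCommGroup.torsion V.A =>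
    (⟨⟨V.toH1 (a : V.A), hmem a⟩, ?_⟩ :
      Submodule.torsion ℤ_[p] (integralH1 (tateRep W p) p (κ.layerSubgroup 0)))) ?_
  · obtain ⟨n, hn, hna⟩ :=
      (isOfFinAddOrder_iff_nsmul_eq_zero).mp ((AddCommGroup.mem_torsion (a : V.A)).mp a.2)
    rw [Submodule.mem_torsion_iff]
    refine ⟨⟨(n : ℤ_[p]), mem_nonZeroDivisors_of_ne_zero (Nat.cast_ne_zero.mpr hn.ne')⟩, Subtype.ext ?_⟩
    change (n : ℤ_[p]) • V.toH1 (a : V.A) = 0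
    rw [Nat.cast_smul_eq_nsmul, ← map_nsmul, hna, map_zero]
  · intro a b h
    have h' : V.toH1 (a : V.A) = V.toH1 (b : V.A) :=
      congrArg (fun t : Submodule.torsion ℤ_[p] (integralH1 (tateRep W p) p (κ.layerSubgroup 0)) =>
        ((t : integralH1 (tateRep W p) p (κ.layerSubgroup 0)) : H1 (tateRep W p) (κ.layerSubgroup 0))) h
    exact Subtype.ext (V.toH1_injective h')

namespace MemberHullCountValueInputs

/-- **THE EXACT RANK-`0` COUNT AT KATO'S MEMBER on this package** — (C1) + (C2) + `#Sel = #Ш[p^∞]`; the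
intermediate orders `#S(T)`, `#A_tors` and the local Tamagawa number at `p` cancel:
`ord_p #Ш(W)[p^∞] + v_p Tam(W) + ord_p [A : Λ·ι(𝐲̄)] = ord_p(L(W,1)/Ω(W)) + v_p λ(0) + ord_p #(𝐇²/X𝐇²) +
2·ord_p #W(ℚ)_tors` (seat kmc's `MemberCountInputs.exactCount`, same arithmetic).  Kernel; nothing assumed.
[cite: Kato2004Asterisque, proof of Prop. 14.16 (pp. 244–245), §14.8 (p. 238)] [cite: GreenbergLNM1716, §3 and appendix to §4] -/
theorem exactCount (Q : MemberHullCountValueInputs W p κ γ I y) :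
    ∃ q : ℚ, W.entireLFunction 1 / (W.realPeriodRat : ℂ) = (q : ℂ) ∧
      (padicValNat p (Nat.card (AddCommGroup.primaryComponent W.sha p)) : ℤ) +
          padicValNat p W.tamagawaProduct +
          padicValNat p (Nat.card (Q.A ⧸ (IwasawaAlgebra p) ∙ Q.ι (Submodule.Quotient.mk y))) =
        padicValRat p q + ((PowerSeries.constantCoeff Q.lam).valuation : ℤ) +
          padicValNat p (Nat.card (coinvariants p Q.H2)) + 2 * (padicValNat p W.torsionOrder : ℤ) := by
  obtain ⟨q, hq, hC1⟩ := Q.count_S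
  have hC2 := Q.index_Sel
  have hSel : (padicValNat p (Nat.card Q.Sel) : ℤ) =
      padicValNat p (Nat.card (AddCommGroup.primaryComponent W.sha p)) := by
    rw [Q.card_Sel]
  exact ⟨q, hq, by linarith⟩

/-- **The composite clause `count` of `MemberHullValueInputs` (`… ≤ … + 3·ord_p #tors`) from the exact
count** (`= … + 2·ord_p #tors`, and `0 ≤ ord_p #tors`).  Kernel; nothing assumed.
[cite: Kato2004Asterisque, Prop. 14.16 (2) (p. 244), §14.8 (p. 238)] -/
theorem count_le (Q : MemberHullCountValueInputs W p κ γ I y) :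
    ∃ q : ℚ, W.entireLFunction 1 / (W.realPeriodRat : ℂ) = (q : ℂ) ∧
      (padicValNat p (Nat.card (AddCommGroup.primaryComponent W.sha p)) : ℤ) +
          padicValNat p W.tamagawaProduct +
          padicValNat p (Nat.card (Q.A ⧸ (IwasawaAlgebra p) ∙ Q.ι (Submodule.Quotient.mk y))) ≤
        padicValRat p q + ((PowerSeries.constantCoeff Q.lam).valuation : ℤ) +
          padicValNat p (Nat.card (coinvariants p Q.H2)) + 3 * (padicValNat p W.torsionOrder : ℤ) := by
  obtain ⟨q, hq, h⟩ := Q.exactCount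
  have ht : (0 : ℤ) ≤ (padicValNat p W.torsionOrder : ℤ) := Nat.cast_nonneg _
  exact ⟨q, hq, by linarith⟩

/-- **Forget the counts: the value package `MemberHullValueInputs`** (every kept field copied; `count`
from `count_le`). [cite: Kato2004Asterisque, Thm. 12.6 (p. 222), §14.14 (14.14.1) (p. 243), Prop. 14.16 (2) (p. 244)] -/
def toMemberHullValueInputs (Q : MemberHullCountValueInputs W p κ γ I y) :
    MemberHullValueInputs W p κ γ I y where
  F := Q.F
  finite_F := Q.finite_F
  torsionFree_F := Q.torsionFree_F
  j := Q.j
  j_injective := Q.j_injective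
  finite_coker := Q.finite_coker
  z := Q.z
  lam := Q.lam
  j_y := Q.j_y
  H2 := Q.H2
  finite_H2 := Q.finite_H2
  isTorsion_H2 := Q.isTorsion_H2
  A := Q.A
  toH1 := Q.toH1
  toH1_injective := Q.toH1_injective
  mem_range_toH1_iff := Q.mem_range_toH1_iff
  toH1_smul := Q.toH1_smul
  ι := Q.ι
  π := Q.π
  π_surjective := Q.π_surjective
  exact_ι_π := Q.exact_ι_π
  toH1_ι := Q.toH1_ι
  divisibility_offP := Q.divisibility_offP
  mu_H2 := Q.mu_H2
  count := Q.count_le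

/-- **Thm. 14.5 (1) on this package: the torsion of the pinned `A` is finite** (`finite_torsion_A'` of
the value package). [cite: Kato2004Asterisque, Thm. 14.5 (1) (p. 236)] -/
theorem finite_torsion_A (Q : MemberHullCountValueInputs W p κ γ I y) :
    Finite (AddCommGroup.torsion Q.A) :=
  Q.toMemberHullValueInputs.finite_torsion_A'

/-- **A pair `(P : MemberHullInputs, C : MemberCountInputs … P)` forgets to this package** (drop the
eight algebraic/value clauses of `P` and `finite_torsion_A` of `C`).
[cite: Kato2004Asterisque, Thm. 12.6 (p. 222), proof of Prop. 14.16 (pp. 244–245)] -/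
def ofCount (P : MemberHullInputs W p κ γ I y) (C : MemberCountInputs W p κ γ I y P) :
    MemberHullCountValueInputs W p κ γ I y where
  F := P.F
  finite_F := P.finite_F
  torsionFree_F := P.torsionFree_F
  j := P.j
  j_injective := P.j_injective
  finite_coker := P.finite_coker
  z := P.z
  lam := P.lam
  j_y := P.j_y
  H2 := P.H2
  finite_H2 := P.finite_H2
  isTorsion_H2 := P.isTorsion_H2
  A := P.A
  toH1 := P.toH1
  toH1_injective := P.toH1_injective
  mem_range_toH1_iff := P.mem_range_toH1_iff
  toH1_smul := P.toH1_smul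
  ι := P.ι
  π := P.π
  π_surjective := P.π_surjective
  exact_ι_π := P.exact_ι_π
  toH1_ι := P.toH1_ι
  divisibility_offP := P.divisibility_offP
  mu_H2 := P.mu_H2
  S := C.S
  finite_S := C.finite_S
  Sel := C.Sel
  card_Sel := C.card_Sel
  index_Sel := C.index_Sel
  count_S := C.count_S

/-- **Back to the ORIGINAL package `MemberHullInputs`, the eight dropped clauses SUPPLIED as hypotheses**
(`κ` cyclotomic, `γ` a topological generator supply `finite_H`, `torsionFree_H`, `ι_injective` by the tree
theorems; `z_ne_zero`, `isTorsion_quotient`, `lam_constantCoeff_ne_zero`, `index_ne_zero`,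
`finite_coinvariants_H2` are the hypotheses — discharged Summits-side on every pin of the member) — the
composite of `toMemberHullValueInputs`, `MemberHullValueInputs.toMemberHullZetaInputs` and
`MemberHullZetaInputs.toMemberHullInputs`.
[cite: Kato2004Asterisque, Thm. 12.5 (1)(2) (pp. 221–222), Lemma 13.10 (1) (p. 230), Thm. 14.5 (1)(2) (p. 236), §14.14 (14.14.1)–(14.14.2) (p. 243)] -/
def toMemberHullInputs (Q : MemberHullCountValueInputs W p κ γ I y) (hκ : κ.IsCyclotomic)
    (hγ : κ.IsTopGenerator γ) (hz : Q.z ≠ 0)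
    (hT : Module.IsTorsion (IwasawaAlgebra p) (Q.F ⧸ (IwasawaAlgebra p) ∙ Q.z))
    (hlam : PowerSeries.constantCoeff Q.lam ≠ 0)
    (hidx : Nat.card (Q.A ⧸ (IwasawaAlgebra p) ∙ Q.ι (Submodule.Quotient.mk y)) ≠ 0)
    (hH2 : Finite (coinvariants p Q.H2)) : MemberHullInputs W p κ γ I y :=
  ((Q.toMemberHullValueInputs).toMemberHullZetaInputs hz hT hlam hidx).toMemberHullInputs hκ hγ hH2

/-- **… and kmc's count package over it** (`finite_torsion_A` proved, the counts copied).
[cite: Kato2004Asterisque, Thm. 14.5 (1) (p. 236), proof of Prop. 14.16 (pp. 244–245), §14.8 (p. 238)] -/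
def toMemberCountInputs (Q : MemberHullCountValueInputs W p κ γ I y) (hκ : κ.IsCyclotomic)
    (hγ : κ.IsTopGenerator γ) (hz : Q.z ≠ 0)
    (hT : Module.IsTorsion (IwasawaAlgebra p) (Q.F ⧸ (IwasawaAlgebra p) ∙ Q.z))
    (hlam : PowerSeries.constantCoeff Q.lam ≠ 0)
    (hidx : Nat.card (Q.A ⧸ (IwasawaAlgebra p) ∙ Q.ι (Submodule.Quotient.mk y)) ≠ 0)
    (hH2 : Finite (coinvariants p Q.H2)) :
    MemberCountInputs W p κ γ I y (Q.toMemberHullInputs hκ hγ hz hT hlam hidx hH2) where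
  finite_torsion_A := Q.finite_torsion_A
  S := Q.S
  finite_S := Q.finite_S
  Sel := Q.Sel
  card_Sel := Q.card_Sel
  index_Sel := Q.index_Sel
  count_S := Q.count_S

end MemberHullCountValueInputs

end Conversions

/-! ## The fact-level forgetful theorem (the `∀∃` shell displayed as a hypothesis; no named fact) -/

/-- **KERNEL, FACT LEVEL: the value-guarded fact `exists_memberHullValueInputs` from the shell «the
value-guarded package WITH THE TWO PRINTED COUNTS exists at Kato's member»** — the hypothesis is VERBATIM
the text of `exists_memberHullValueInputs` with `MemberHullCountValueInputs` for `MemberHullValueInputs`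
(same quantifier prefix: globally minimal `W/ℚ`, `p ≠ 2` ADDITIVE, POTENTIALLY GOOD, `W[p]` REDUCIBLE,
`L(W,1) ≠ 0`, `Ш(W)` finite ⟹ a globally minimal `ℚ`-isogenous member `W_K`, a `ZetaBody` datum for ONE
admissible `(c,d,a,A)` with the displayed guard `(cd,A) = 1 ∧ dd′ ≡ 1 (A) ∧ cuspFactor f true 1 c d a A d′
≠ 0`, and for every cyclotomic `κ`, `γ`, `I : IwasawaH1Data W_K p κ γ` and THE lift `𝐲` of the
corestricted `p`-power levels, `Nonempty (MemberHullCountValueInputs W_K p κ γ I 𝐲)`); the conclusion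
forgets the counts (`toMemberHullValueInputs`).  The hypothesis is the text a planner's consolidation
resplit would file as ONE held child replacing `exists_memberHullZetaInputs` AND
`exists_memberHullCountInputs` (module docstring, TURNKEY); it is NOT named here.  Nothing asserted.
[cite: Kato2004Asterisque, Thm. 12.5 (3) (p. 222), Thm. 12.6 and Rem. 12.7 (p. 222), Lemma 13.10 (1) (p. 230), 13.14 (p. 234), §14.14 (14.14.1)–(14.14.2) (p. 243), Prop. 14.16 (2) and its proof (pp. 244–245), §14.8 (p. 238), (14.9.3) (p. 240)]
[cite: Wuthrich2014, Lemma 14 (p. 396)] [cite: GreenbergLNM1716, §3 and appendix to §4] -/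
theorem exists_memberHullValueInputs_of_countValue
    (h : ∀ (W : WeierstrassCurve ℚ) [W.IsElliptic] [W.IsGloballyMinimal] (p : ℕ) [Fact p.Prime]
      (hp : p ≠ 2),
      ¬ W.HasGoodReductionAtPrime p → ¬ W.HasMultiplicativeReductionAtPrime p →
      0 ≤ padicValRat p W.j →
      ¬ W.HasIrreducibleModPGaloisRep p →
      W.entireLFunction 1 ≠ 0 → Finite W.sha →
      ∃ (W' : WeierstrassCurve ℚ) (_ : W'.IsElliptic) (_ : W'.IsGloballyMinimal),
        WeierstrassCurve.IsIsogenous W W' ∧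
        ∀ [ContinuousSMul ℤ_[p] (W'.tateModule p)] [Module.Free ℤ_[p] (W'.tateModule p)]
          [Module.Finite ℤ_[p] (W'.tateModule p)],
        ∀ {N : ℕ} [NeZero N] (f : CuspForm (Gamma0 N) 2), IsNewformOf W f →
        ∀ (ι : (m : ℕ) → (CyclotomicField m ℚ →+* ℂ)),
        ∃ (κ' : ℝ) (Λ' : ∀ (k : ℕ) (r : Finset (HeightOneSpectrum (𝓞 ℚ))),
            H1 (tateRep W' p) (cycSubgroup p k r) →ₗ[ℤ_[p]] ℚ_[p] ⊗[ℚ] CyclotomicField (cycLevel p k r) ℚ)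
          (c d a : ℤ) (A : ℕ)
          (z : ∀ (k : ℕ) (r : (cyclotomicLevelsRat p (badPlaces c d A N)).Ideals),
            H1 (tateRep W' p) ((cyclotomicLevelsRat p (badPlaces c d A N)).level k r.1))
          (x : ∀ (k : ℕ) (r : (cyclotomicLevelsRat p (badPlaces c d A N)).Ideals),
            CyclotomicField (cycLevel p k r.1) ℚ),
          κ' ≠ 0 ∧ 0 < A ∧ Int.gcd c (6 * p * A) = 1 ∧ Int.gcd d (6 * p * N) = 1 ∧
          Int.gcd (c * d) A = 1 ∧
          (∃ d' : ℤ, d * d' ≡ 1 [ZMOD (A : ℤ)] ∧ cuspFactor f true (fun _ ↦ 1) c d a A d' ≠ 0) ∧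
          ZetaBody W' p f ι κ' Λ' c d a A z x ∧
          ∀ (κ : ZpExtension ℚ p) (γ : absoluteGaloisGroup ℚ) (hκ : κ.IsCyclotomic),
            κ.IsTopGenerator γ →
            ∀ (I : IwasawaH1Data W' p κ γ) (y : I.H),
              (∀ n : ℕ, I.proj n y = levelToLayer W' p hκ hp (badPlaces c d A N) n
                (z (n + 1) (cyclotomicLevelsRat p (badPlaces c d A N)).idealOne)) →
              Nonempty (MemberHullCountValueInputs W' p κ γ I y)) :
    exists_memberHullValueInputs := by
  intro W _ _ p _ hp hgood hmult hj hirr hL hsha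
  obtain ⟨W', hW'e, hW'm, hiso, hrest⟩ := h W p hp hgood hmult hj hirr hL hsha
  refine ⟨W', hW'e, hW'm, hiso, ?_⟩
  intro _ _ _ N _ f hf ι
  obtain ⟨κ', Λ', c, d, a, A, z, x, hκ', hA, hc, hd, hcd, hguard, hZB, hall⟩ := hrest f hf ι
  refine ⟨κ', Λ', c, d, a, A, z, x, hκ', hA, hc, hd, hcd, hguard, hZB, ?_⟩
  intro κ γ hκ hγ I y hy
  obtain ⟨Q⟩ := hall κ γ hκ hγ I y hy
  exact ⟨Q.toMemberHullValueInputs⟩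

-- TODO(general form): as in the sources — every stable lattice of `V_{F_λ}(f)` (weight `k`,
-- coefficients), `p = 2` up to `×2`, the member NAMED, `S(T)`/`Sel(T)`/(14.9.3) and `𝐇²`, the hull
-- CONSTRUCTED on the tree's Galois cohomology (then (C1), (C2), (14.14.1) become theorems of Poitou–Tate
-- and of Kato's Euler system).

end Literature.NumberTheory.EllipticCurves.Kato2004

end
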